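import Summits.Ventures.YMGap.RobustBall.StarTiltComparison
import Summits.Ventures.YMGap.RobustBall.StarDoorZdPerturbed
import Summits.Ventures.YMGap.RobustBall.StarChartKernel
import HarnessLib

/-!
# Venture YMGap, track ROBUST-BALL (Y2) — crux «Y2-X2-P», STEP 3 / P3: the GLOBAL WINDOW CONTRACTION of the star kernels of a
# summable member at one vertex from ABSTRACT FAR LOADS (near array of the truncation + far tilt), weight-agnostic

HONEST FRAMING. WHAT THIS IS: a venture file (cell `pub-ymgap`, track Y2 ROBUST-BALL, seat ds-2 (g15); lead R392 (B) STEP 3; theorems only,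
0 compute). The tree's tier-2 one-centre contraction `tier2_star_contraction` (`RobustStarWindowZdW.lean`) is stated for a member of the
EXPONENTIALLY weighted ball `MemBallZdW κ ε₀ ε₁` and derives its far loads from the weight `e^{κ·diam}` inside the proof. Its mechanism —
kernel split `perturbedYMS_eq_tilted_truncZd`, properness, the sitewise-to-global near contraction `window_contraction_global_of_sitewise`
with the locality `perturbed_star_hloc`, and the tilt comparison `tilt_comparison` — uses the weight ONLY through four far-load facts. Here the
SAME proof is run with those facts as HYPOTHESES (`star_contraction_of_farLoads`): for a link-summable `W` with continuous own-link terms and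
Frobenius-Lipschitz witnesses `lip`, a box radius `D` such that every truncation `truncZd D s W` is a tier-1 member `MemBallZdG ε₀ ε₁ (2D)`,
summable Lipschitz mass of the FAR sets (meeting the star, leaving the box) at each vertex, summable far star-link series `ℓ_x = Σ'_{FAR ∋ x} lip_X(x)` with `Σ_{x ∈ ⋆} ℓ_x ≤ FL`,
summable far exterior series `L_y`, a tilt bound `τ̄ ≥ 2√N·FL`, and ANY star window array `Kn` of the truncations with locality radius
`D' ≥ 2D+2`: the star kernel of `perturbedYMS (fundamentalRep (Fin N)) β W` at the centre `c` satisfies the GLOBAL window contraction with the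
array `KZ(s; y → z) = E² Kn(s; y → z) + C₁ Σ_{x ∈ ⋆} ℓ_x Kn(s; y → x) + C₂ L_y` (`z ∈ ⋆_s`), `E = e^{τ̄}`, `C₁ = 2√N(E²+E⁴)`, `C₂ = 2C₁`.
It serves the tier-3 (POLYNOMIALLY weighted) ball `MemBallZdP` (`PolyClusteringOnBallZd.lean`), whose far loads are supplied by
`StarFarLoadsZdP.lean`, and recovers the tier-2 statement. WHAT THIS IS NOT: no door, no number; strong-coupling LATTICE bookkeeping —
nothing about the continuum or the Millennium problem; the tier-3 target is power-law clustering, weaker than a mass gap.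
-/

noncomputable section

open MeasureTheory ProbabilityTheory Function Finset Real
open scoped NNReal
open Literature.Probability.LatticeModels
open Literature.Probability.LatticeModels.DobrushinMetric
open Literature.MathematicalPhysics.QuantumLattice hiding torusNorm
open Literature.MathematicalPhysics.QuantumFieldTheory hiding ZdEdge
open Summit.Ventures.YMGap.DSWindowZd

namespace Summit.Ventures.YMGap.RobustBall

variable {d N : ℕ}

/-- **THE GLOBAL WINDOW CONTRACTION OF THE STAR KERNEL OF A SUMMABLE MEMBER AT ONE CENTRE, FROM ABSTRACT FAR LOADS.** See the
module docstring: `W` link-summable with continuous own-link terms and Lipschitz witnesses `lip`; every radius-`D` truncation a tier-1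
member `MemBallZdG ε₀ ε₁ (2D)` (`hn`); summable Lipschitz mass of the far sets meeting each star (`hms`); summable far star-link series with
`Σ_{x ∈ ⋆} ℓ_x ≤ FL` (`hℓsum`, `hℓle`); summable far exterior series (`hLsum`); `2√N·FL ≤ τ̄` (`hτb`); a near array `Kn` with locality
radius `D' ≥ 2D + 2` and the sitewise one-boundary-link contraction for rb-p1's `perturbedYM` of the truncations (`hKnH1`); the array `KZ`
is any function agreeing with the displayed expression (`hKZ_apply`). Weight-agnostic form of `tier2_star_contraction`. [folklore] -/
theorem star_contraction_of_farLoads {β ε₀ ε₁ FL τb : ℝ} {D D' : ℕ} (hD'eq : 2 * D + 2 ≤ D')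
    {W : Potential (ZdEdge d) (SUN N)} (hWc : ∀ X, Continuous (W X))
    (hWdep : ∀ X, DependsOn (W X) (↑X : Set (ZdEdge d))) {Bm : Finset (ZdEdge d) → ℝ}
    (hBm : IsLinkSummable W Bm) {lip : Finset (ZdEdge d) → ZdEdge d → ℝ}
    (hlip : ∀ X, IsLipBound suFrobDist (W X) (lip X))
    (hn : ∀ s : Site d, MemBallZdG ε₀ ε₁ (2 * D) (truncZd D s W) (truncSuppZd D s))
    (hms : ∀ s : Site d, Summable fun X : Finset (ZdEdge d) =>
      (if (X ∩ vertexStarZd s).Nonempty ∧ ¬ X ⊆ starNbhdZdR D s then ∑ y ∈ X, lip X y else 0))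
    (hℓsum : ∀ (s : Site d) (x : ZdEdge d), Summable fun X : Finset (ZdEdge d) =>
      (if ((X ∩ vertexStarZd s).Nonempty ∧ ¬ X ⊆ starNbhdZdR D s) ∧ x ∈ X then lip X x else 0))
    (hℓle : ∀ s : Site d, ∑ x ∈ vertexStarZd s, ∑' X : Finset (ZdEdge d),
      (if ((X ∩ vertexStarZd s).Nonempty ∧ ¬ X ⊆ starNbhdZdR D s) ∧ x ∈ X then lip X x else 0) ≤ FL)
    (hLsum : ∀ s : Site d, Summable fun y : ZdEdge d => ∑' X : Finset (ZdEdge d),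
      (if ((X ∩ vertexStarZd s).Nonempty ∧ ¬ X ⊆ starNbhdZdR D s) ∧ y ∈ X ∧ y ∉ vertexStarZd s
        then lip X y else 0))
    (hτb : (2 * Real.sqrt ((N : ℕ) : ℝ)) * FL ≤ τb)
    {Kn : Site d → Site d → ZdEdge d → ZdEdge d → ℝ} (hKn0 : ∀ s s' y x, 0 ≤ Kn s s' y x)
    (hKnsupp : ∀ s s' y x, Kn s s' y x ≠ 0 → y ∈ starNbhdZdR D' s')
    (hKnH1 : ∀ (s : Site d) (c y : ZdEdge d), y ∉ starWinZd c →
      ∀ (ω η : LGConfig d (SUN N)), (∀ v, v ≠ y → ω v = η v) →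
      ∀ (f : LGConfig d (SUN N) → ℝ) (δ : ZdEdge d → ℝ), Measurable f → (∃ B, ∀ σ, |f σ| ≤ B) →
        DependsOn f (starWinZd c : Set (ZdEdge d)) → (∀ x, 0 ≤ δ x) →
        (∀ (x : ZdEdge d) (σ τ : LGConfig d (SUN N)), (∀ v, v ≠ x → σ v = τ v) →
          |f σ - f τ| ≤ δ x * suFrobDist (σ x) (τ x)) →
          |∫ σ, f σ ∂(perturbedYM (d := d) (fundamentalRep (Fin N)) β (truncZd D s W) (truncSuppZd D s) (starWinZd c) ω) -
            ∫ σ, f σ ∂(perturbedYM (d := d) (fundamentalRep (Fin N)) β (truncZd D s W) (truncSuppZd D s) (starWinZd c) η)| ≤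
            (∑ x ∈ starWinZd c, Kn s c.1 y x * δ x) * suFrobDist (ω y) (η y))
    {KZ : Site d → ZdEdge d → ZdEdge d → ℝ}
    (hKZ_apply : ∀ s y z, KZ s y z = if z ∈ vertexStarZd s then
      Real.exp τb ^ 2 * Kn s s y z +
        (2 * Real.sqrt ((N : ℕ) : ℝ)) * (Real.exp τb ^ 2 + Real.exp τb ^ 4) *
          (∑ x ∈ vertexStarZd s, (∑' X : Finset (ZdEdge d),
            (if ((X ∩ vertexStarZd s).Nonempty ∧ ¬ X ⊆ starNbhdZdR D s) ∧ x ∈ X then lip X x else 0)) * Kn s s y x) +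
        2 * (2 * Real.sqrt ((N : ℕ) : ℝ)) * (Real.exp τb ^ 2 + Real.exp τb ^ 4) *
          (∑' X : Finset (ZdEdge d),
            (if ((X ∩ vertexStarZd s).Nonempty ∧ ¬ X ⊆ starNbhdZdR D s) ∧ y ∈ X ∧ y ∉ vertexStarZd s then lip X y else 0))
      else 0)
    (c : ZdEdge d) (ω η : LGConfig d (SUN N)) (f : LGConfig d (SUN N) → ℝ) (δ : ZdEdge d → ℝ)
    (hfm : Measurable f) (hfB : ∃ B, ∀ σ, |f σ| ≤ B) (hfdep : DependsOn f (starWinZd c : Set (ZdEdge d)))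
    (hδ0 : ∀ x, 0 ≤ δ x)
    (hδ : ∀ (x : ZdEdge d) (σ τ : LGConfig d (SUN N)), (∀ v, v ≠ x → σ v = τ v) →
      |f σ - f τ| ≤ δ x * suFrobDist (σ x) (τ x)) :
    |∫ σ, f σ ∂(perturbedYMS (d := d) (fundamentalRep (Fin N)) β W (starWinZd c) ω) -
        ∫ σ, f σ ∂(perturbedYMS (d := d) (fundamentalRep (Fin N)) β W (starWinZd c) η)| ≤
      ∑ x ∈ starWinZd c, δ x * ∑' y, KZ c.1 y x * suFrobDist (ω y) (η y) := by
  classical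
  haveI : SecondCountableTopology (Matrix (Fin N) (Fin N) ℂ) :=
    inferInstanceAs (SecondCountableTopology (Fin N → Fin N → ℂ))
  haveI : SecondCountableTopology (SUN N) := Topology.IsEmbedding.subtypeVal.secondCountableTopology
  set ρG := fundamentalRep (Fin N) with hρG
  have hρc : Continuous ρG := continuous_fundamentalRep (Fin N)
  set Rr : ℝ := 2 * Real.sqrt ((N : ℕ) : ℝ) with hRr
  have hRr0 : 0 ≤ Rr := by positivity
  set E : ℝ := Real.exp τb with hE
  set C₁ : ℝ := Rr * (E ^ 2 + E ^ 4) with hC₁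
  set C₂ : ℝ := 2 * Rr * (E ^ 2 + E ^ 4) with hC₂
  have hE0 : 0 < E := Real.exp_pos _
  have hC₁0 : 0 ≤ C₁ := by positivity
  have hC₂0 : 0 ≤ C₂ := by positivity
  set ℓ : Site d → ZdEdge d → ℝ := fun s x => ∑' X : Finset (ZdEdge d),
    (if ((X ∩ vertexStarZd s).Nonempty ∧ ¬ X ⊆ starNbhdZdR D s) ∧ x ∈ X then lip X x else 0) with hℓ
  set L : Site d → ZdEdge d → ℝ := fun s y => ∑' X : Finset (ZdEdge d),
    (if ((X ∩ vertexStarZd s).Nonempty ∧ ¬ X ⊆ starNbhdZdR D s) ∧ y ∈ X ∧ y ∉ vertexStarZd s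
      then lip X y else 0) with hL
  have hℓ0 : ∀ s x, 0 ≤ ℓ s x := fun s x => tsum_nonneg fun X => by split_ifs; exacts [(hlip X).nonneg x, le_rfl]
  have hL0 : ∀ s y, 0 ≤ L s y := fun s y => tsum_nonneg fun X => by split_ifs; exacts [(hlip X).nonneg y, le_rfl]
  set s : Site d := c.1 with hs
  have hstar : starWinZd c = vertexStarZd s := rfl
  -- the near specification at `s`
  set Wn := truncZd D s W with hWn
  set supp := truncSuppZd D s with hsupp
  have hWnc : ∀ X, Continuous (Wn X) := (hn s).continuous
  have hWnm : ∀ X, Measurable (Wn X) := fun X => (hWnc X).measurable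
  have hWnb : ∀ X, ∃ C, ∀ U, |Wn X U| ≤ C := fun X => exists_bound_of_continuous (hWnc X)
  have hγn : IsSpecification (perturbedYM (d := d) ρG β Wn supp) :=
    isSpecification_perturbedYM ρG hρc β (fun X => ⟨(hn s).dependsOn X, hWnm X⟩) hWnb (hn s).supportedBy
  set μ₁ := perturbedYM (d := d) ρG β Wn supp (starWinZd c) ω with hμ₁
  set μ₂ := perturbedYM (d := d) ρG β Wn supp (starWinZd c) η with hμ₂
  haveI : IsProbabilityMeasure μ₁ := isProbabilityMeasure_perturbedYM ρG hρc β hWnm hWnb supp _ ω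
  haveI : IsProbabilityMeasure μ₂ := isProbabilityMeasure_perturbedYM ρG hρc β hWnm hWnb supp _ η
  -- the far energy and its bounds
  set h := farEnergyZd D s (starWinZd c) W with hh
  have hhc : Continuous h := continuous_farEnergyZd hBm hWc D s _
  obtain ⟨σ₀⟩ : Nonempty (LGConfig d (SUN N)) := ⟨fun _ => 1⟩
  set pw : LGConfig d (SUN N) → LGConfig d (SUN N) → LGConfig d (SUN N) :=
    fun ζ σ => (starWinZd c).piecewise σ ζ with hpw
  have hpwm : ∀ ζ, Measurable (pw ζ) := fun ζ => DobrushinShlosman.measurable_piecewise_conf _ ζ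
  -- normalised far exponents at the two exteriors
  set hω : LGConfig d (SUN N) → ℝ := fun σ => h (pw ω σ) - h (pw ω σ₀) with hhω
  set hη : LGConfig d (SUN N) → ℝ := fun σ => h (pw η σ) - h (pw η σ₀) with hhη
  have hhωm : Measurable hω := (hhc.measurable.comp (hpwm ω)).sub measurable_const
  have hhηm : Measurable hη := (hhc.measurable.comp (hpwm η)).sub measurable_const
  -- Lipschitz of `σ ↦ h (pw ζ σ)` in every link, with the far star-link constants
  have hlipζ : ∀ (ζ : LGConfig d (SUN N)) (x : ZdEdge d) (σ τ' : LGConfig d (SUN N)),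
      (∀ v, v ≠ x → σ v = τ' v) → |h (pw ζ σ) - h (pw ζ τ')| ≤ ℓ s x * suFrobDist (σ x) (τ' x) := by
    intro ζ x σ τ' hστ
    by_cases hx : x ∈ starWinZd c
    · have hdiff : ∀ z, z ≠ x → pw ζ σ z = pw ζ τ' z := by
        intro z hz
        by_cases hzs : z ∈ starWinZd c
        · simp only [hpw, Finset.piecewise_eq_of_mem _ _ _ hzs]; exact hστ z hz
        · simp only [hpw, Finset.piecewise_eq_of_notMem _ _ _ hzs]
      have key := abs_farEnergyZd_sub_le_link hBm hWdep hlip D s (starWinZd c) (hℓsum s x) hdiff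
      simp only [hpw, Finset.piecewise_eq_of_mem _ _ _ hx] at key ⊢
      exact key
    · have : pw ζ σ = pw ζ τ' := by
        funext z
        by_cases hzs : z ∈ starWinZd c
        · simp only [hpw, Finset.piecewise_eq_of_mem _ _ _ hzs]; exact hστ z (fun h => hx (h ▸ hzs))
        · simp only [hpw, Finset.piecewise_eq_of_notMem _ _ _ hzs]
      rw [this, sub_self, abs_zero]; exact mul_nonneg (hℓ0 s x) (suFrobDist_nonneg _ _)
  have hdepζ : ∀ ζ : LGConfig d (SUN N), DependsOn (fun σ => h (pw ζ σ)) (starWinZd c : Set (ZdEdge d)) := by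
    intro ζ σ τ' hστ
    simp only
    congr 1
    funext z
    by_cases hzs : z ∈ starWinZd c
    · simp only [hpw, Finset.piecewise_eq_of_mem _ _ _ hzs]; exact hστ z (Finset.mem_coe.2 hzs)
    · simp only [hpw, Finset.piecewise_eq_of_notMem _ _ _ hzs]
  -- the sup bound `τb`
  have hτ : ∀ (ζ σ : LGConfig d (SUN N)), |h (pw ζ σ) - h (pw ζ σ₀)| ≤ τb := by
    intro ζ σ
    have hlb : IsLipBound suFrobDist (fun σ => h (pw ζ σ)) (fun x => if x ∈ starWinZd c then ℓ s x else 0) := by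
      refine ⟨fun x => by split_ifs; exacts [hℓ0 s x, le_rfl], fun x σ τ' hστ => ?_⟩
      split_ifs with hx
      · exact hlipζ ζ x σ τ' hστ
      · have e : h (pw ζ σ) = h (pw ζ τ') :=
          (hdepζ ζ) (fun z hz => hστ z fun h => hx (h ▸ Finset.mem_coe.1 hz))
        rw [e, sub_self, abs_zero, zero_mul]
    have h1 := abs_sub_le_sum_of_dependsOn (hdepζ ζ) hlb σ σ₀
    refine h1.trans (le_trans ?_ hτb)
    calc ∑ y ∈ starWinZd c, (if y ∈ starWinZd c then ℓ s y else 0) * suFrobDist (σ y) (σ₀ y)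
        ≤ ∑ y ∈ starWinZd c, ℓ s y * Rr := Finset.sum_le_sum fun y hy => by
          rw [if_pos hy]; exact mul_le_mul_of_nonneg_left (suFrobDist_le _ _) (hℓ0 s y)
      _ = Rr * ∑ y ∈ starWinZd c, ℓ s y := by rw [← Finset.sum_mul, mul_comm]
      _ ≤ Rr * FL := by
          have h2 : ∑ y ∈ starWinZd c, ℓ s y ≤ FL := hℓle s
          exact mul_le_mul_of_nonneg_left h2 hRr0
  have hτω : ∀ σ, |hω σ| ≤ τb := fun σ => hτ ω σ
  have hτη : ∀ σ, |hη σ| ≤ τb := fun σ => hτ η σ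
  -- closeness of the two exponents: the exterior series `u`
  set u : ℝ := ∑' y : ZdEdge d, L s y * suFrobDist (ω y) (η y) with hu
  have hLsum : Summable fun y => L s y * suFrobDist (ω y) (η y) := by
    have h1 : Summable fun y => L s y := hLsum s
    exact Summable.of_nonneg_of_le (fun y => mul_nonneg (hL0 s y) (suFrobDist_nonneg _ _))
      (fun y => mul_le_mul_of_nonneg_left (suFrobDist_le _ _) (hL0 s y)) (h1.mul_right _)
  have hfar : ∀ σ : LGConfig d (SUN N), |h (pw ω σ) - h (pw η σ)| ≤ u := fun σ =>
    abs_farEnergyZd_piecewise_sub_le hBm hWdep hlip D s (starWinZd c) (hms s) σ ω η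
  have hclose2 : ∀ σ, |hω σ - hη σ| ≤ 2 * u := fun σ => by
    have e : hω σ - hη σ = (h (pw ω σ) - h (pw η σ)) - (h (pw ω σ₀) - h (pw η σ₀)) := by
      simp only [hhω, hhη]; ring
    rw [e]
    calc |(h (pw ω σ) - h (pw η σ)) - (h (pw ω σ₀) - h (pw η σ₀))|
        ≤ |h (pw ω σ) - h (pw η σ)| + |h (pw ω σ₀) - h (pw η σ₀)| := abs_sub _ _
      _ ≤ u + u := add_le_add (hfar σ) (hfar σ₀)
      _ = 2 * u := by ring
  -- the test function, centred
  set f₀ : LGConfig d (SUN N) → ℝ := fun σ => f σ - f σ₀ with hf₀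
  have hf₀m : Measurable f₀ := hfm.sub measurable_const
  have hf₀dep : DependsOn f₀ (starWinZd c : Set (ZdEdge d)) := fun σ τ' h => by simp only [hf₀]; rw [hfdep h]
  have hf₀lip : ∀ (x : ZdEdge d) (σ τ' : LGConfig d (SUN N)), (∀ v, v ≠ x → σ v = τ' v) →
      |f₀ σ - f₀ τ'| ≤ δ x * suFrobDist (σ x) (τ' x) := fun x σ τ' h => by
    simp only [hf₀]; rw [show f σ - f σ₀ - (f τ' - f σ₀) = f σ - f τ' by ring]; exact hδ x σ τ' h
  set F : ℝ := Rr * ∑ x ∈ starWinZd c, δ x with hF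
  have hF0 : 0 ≤ F := mul_nonneg hRr0 (Finset.sum_nonneg fun x _ => hδ0 x)
  have hfF : ∀ σ, |f₀ σ| ≤ F := fun σ => by
    have hlb : IsLipBound suFrobDist f δ := ⟨hδ0, hδ⟩
    have h1 := abs_sub_le_sum_of_dependsOn hfdep hlb σ σ₀
    refine h1.trans ?_
    rw [hF, Finset.mul_sum]
    exact Finset.sum_le_sum fun x _ => by
      rw [mul_comm]; exact mul_le_mul_of_nonneg_right (suFrobDist_le _ _) (hδ0 x)
  -- the near window contraction, global form, at the exteriors `ω, η`
  set Nb := starNbhdZdR D' s with hNb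
  set A : ZdEdge d → ℝ := fun x => ∑ y ∈ Nb, Kn s s y x * suFrobDist (ω y) (η y) with hA
  have hnear : ∀ (g : LGConfig d (SUN N) → ℝ) (δ' : ZdEdge d → ℝ), Measurable g → (∃ B, ∀ σ, |g σ| ≤ B) →
      DependsOn g (starWinZd c : Set (ZdEdge d)) → (∀ x, 0 ≤ δ' x) →
      (∀ (x : ZdEdge d) (σ τ' : LGConfig d (SUN N)), (∀ v, v ≠ x → σ v = τ' v) →
        |g σ - g τ'| ≤ δ' x * suFrobDist (σ x) (τ' x)) →
        |∫ σ, g σ ∂μ₁ - ∫ σ, g σ ∂μ₂| ≤ ∑ x ∈ starWinZd c, δ' x * A x := by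
    intro g δ' hgm hgB hgdep hδ'0 hδ'
    exact window_contraction_global_of_sitewise hγn suFrobDist_nonneg (c := c) (Nb := Nb) (K := Kn s s)
      (hKn0 s s) (fun y hy ω' η' hωη g' δ'' hg'm hg'B hg'dep hδ''0 hδ'' =>
        hKnH1 s c y hy ω' η' hωη g' δ'' hg'm hg'B hg'dep hδ''0 hδ'')
      (fun ζ ζ' hζ g' hg'm _ hg'dep => perturbed_star_hloc ρG hρc β hWnm (hn s).dependsOn (hn s).supportedBy
        (R := 2 * D) (D := D') (fun e X hX he y hy => (hn s).range e X hX he y hy) hD'eq c ζ ζ' hζ g' hg'm hg'dep)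
      ω η hgm hgB hgdep hδ'0 hδ'
  -- the tilt comparison
  have htilt := tilt_comparison (S := starWinZd c) (r := suFrobDist) (μ₁ := μ₁) (μ₂ := μ₂) (A := A) hnear hf₀m hF0
    hfF hf₀dep hδ0 hf₀lip hhωm hhηm hτω hτη
    (fun σ τ' hστ => by
      have e : h (pw ω σ) = h (pw ω τ') := (hdepζ ω) hστ
      simp only [hhω, e])
    (hℓ0 s) (fun x σ τ' hστ => by
      simp only [hhω]
      rw [show h (pw ω σ) - h (pw ω σ₀) - (h (pw ω τ') - h (pw ω σ₀)) = h (pw ω σ) - h (pw ω τ') by ring]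
      exact hlipζ ω x σ τ' hστ) hclose2
  -- identification of the two tier-2 kernels with the tilted near kernels
  have hsplit : ∀ ζ : LGConfig d (SUN N), perturbedYMS (d := d) ρG β W (starWinZd c) ζ =
      (perturbedYM (d := d) ρG β Wn supp (starWinZd c) ζ).tilted fun U => -h U := fun ζ =>
    perturbedYMS_eq_tilted_truncZd ρG hρc hBm hWc β D s (starWinZd c) ζ
  have hratio : ∀ (ζ : LGConfig d (SUN N)) (μ : Measure (LGConfig d (SUN N))),
      μ = perturbedYM (d := d) ρG β Wn supp (starWinZd c) ζ → IsProbabilityMeasure μ →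
      ∫ σ, f σ ∂(perturbedYMS (d := d) ρG β W (starWinZd c) ζ) - f σ₀ =
        (∫ σ, Real.exp (-(h (pw ζ σ) - h (pw ζ σ₀))) * f₀ σ ∂μ) /
          ∫ σ, Real.exp (-(h (pw ζ σ) - h (pw ζ σ₀))) ∂μ := by
    intro ζ μ hμ _
    rw [hsplit ζ, ← hμ, integral_tilted_eq_div]
    -- properness: read everything through `pw ζ`
    have hp1 : ∫ U, Real.exp (-h U) * f U ∂μ = ∫ σ, Real.exp (-h (pw ζ σ)) * f σ ∂μ := by
      rw [hμ, DobrushinShlosman.windowAvg_eq_integral_piecewise hγn (starWinZd c) (fun U => Real.exp (-h U) * f U) ζ]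
      refine integral_congr_ae (ae_of_all _ fun σ => ?_)
      have e : f ((starWinZd c).piecewise σ ζ) = f σ :=
        hfdep (fun z hz => Finset.piecewise_eq_of_mem _ _ _ (Finset.mem_coe.1 hz))
      simp only [hpw, e]
    have hp2 : ∫ U, Real.exp (-h U) ∂μ = ∫ σ, Real.exp (-h (pw ζ σ)) ∂μ := by
      rw [hμ, DobrushinShlosman.windowAvg_eq_integral_piecewise hγn (starWinZd c) (fun U => Real.exp (-h U)) ζ]
    rw [hp1, hp2]
    -- pull out the constant `e^{-h(pw ζ σ₀)}` and centre `f`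
    set Cz : ℝ := Real.exp (-h (pw ζ σ₀)) with hCz
    have hCz0 : 0 < Cz := Real.exp_pos _
    have he : ∀ σ, Real.exp (-h (pw ζ σ)) = Cz * Real.exp (-(h (pw ζ σ) - h (pw ζ σ₀))) := fun σ => by
      rw [hCz, ← Real.exp_add]; ring_nf
    simp_rw [he]
    have hem : Measurable fun σ => Real.exp (-(h (pw ζ σ) - h (pw ζ σ₀))) :=
      ((hhc.measurable.comp (hpwm ζ)).sub measurable_const).neg.exp
    have heB : ∀ σ, |Real.exp (-(h (pw ζ σ) - h (pw ζ σ₀)))| ≤ Real.exp τb := fun σ => by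
      rw [abs_of_pos (Real.exp_pos _)]
      exact Real.exp_le_exp.2 (by linarith [(abs_le.1 (hτ ζ σ)).1])
    obtain ⟨Bf, hBf⟩ := hfB
    have hie : Integrable (fun σ => Real.exp (-(h (pw ζ σ) - h (pw ζ σ₀)))) μ := integrable_of_abs_le' hem heB
    have hief : Integrable (fun σ => Real.exp (-(h (pw ζ σ) - h (pw ζ σ₀))) * f σ) μ :=
      integrable_of_abs_le' (hem.mul hfm) (M := Real.exp τb * |Bf| ⊔ (Real.exp τb * Bf)) fun σ => by
        rw [abs_mul]
        exact (mul_le_mul (heB σ) (hBf σ) (abs_nonneg _) (Real.exp_pos _).le).trans (le_sup_right)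
    have hief₀ : Integrable (fun σ => Real.exp (-(h (pw ζ σ) - h (pw ζ σ₀))) * f₀ σ) μ :=
      integrable_of_abs_le' (hem.mul hf₀m) (M := Real.exp τb * F) fun σ => by
        rw [abs_mul]; exact mul_le_mul (heB σ) (hfF σ) (abs_nonneg _) (Real.exp_pos _).le
    have hpos : 0 < ∫ σ, Real.exp (-(h (pw ζ σ) - h (pw ζ σ₀))) ∂μ := by
      have h1 : Real.exp (-τb) ≤ ∫ σ, Real.exp (-(h (pw ζ σ) - h (pw ζ σ₀))) ∂μ := by
        calc Real.exp (-τb) = ∫ _σ, Real.exp (-τb) ∂μ := by simp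
          _ ≤ _ := integral_mono (integrable_const _) hie fun σ =>
              Real.exp_le_exp.2 (by linarith [(abs_le.1 (hτ ζ σ)).2])
      exact lt_of_lt_of_le (Real.exp_pos _) h1
    have hnum : ∫ σ, Cz * Real.exp (-(h (pw ζ σ) - h (pw ζ σ₀))) * f σ ∂μ =
        Cz * ∫ σ, Real.exp (-(h (pw ζ σ) - h (pw ζ σ₀))) * f σ ∂μ := by
      rw [← integral_const_mul]; exact integral_congr_ae (ae_of_all _ fun σ => by ring)
    rw [hnum, integral_const_mul, mul_div_mul_left _ _ hCz0.ne']
    have hlin : ∫ σ, Real.exp (-(h (pw ζ σ) - h (pw ζ σ₀))) * f₀ σ ∂μ =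
        ∫ σ, Real.exp (-(h (pw ζ σ) - h (pw ζ σ₀))) * f σ ∂μ -
          f σ₀ * ∫ σ, Real.exp (-(h (pw ζ σ) - h (pw ζ σ₀))) ∂μ := by
      rw [← integral_const_mul, ← integral_sub hief (hie.const_mul _)]
      exact integral_congr_ae (ae_of_all _ fun σ => by simp only [hf₀]; ring)
    rw [hlin, sub_div, mul_div_assoc, div_self hpos.ne', mul_one]
  have hid₁ := hratio ω μ₁ hμ₁ inferInstance
  have hid₂ := hratio η μ₂ hμ₂ inferInstance
  have hΔ : ∫ σ, f σ ∂(perturbedYMS (d := d) ρG β W (starWinZd c) ω) -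
      ∫ σ, f σ ∂(perturbedYMS (d := d) ρG β W (starWinZd c) η) =
      (∫ σ, Real.exp (-hω σ) * f₀ σ ∂μ₁) / (∫ σ, Real.exp (-hω σ) ∂μ₁) -
        (∫ σ, Real.exp (-hη σ) * f₀ σ ∂μ₂) / (∫ σ, Real.exp (-hη σ) ∂μ₂) := by
    have e : ∀ a b c : ℝ, a - b = (a - c) - (b - c) := fun a b c => by ring
    rw [e _ _ (f σ₀), hid₁, hid₂]
  rw [hΔ]
  refine htilt.trans ?_
  -- bookkeeping: the right-hand side is `Σ_z δ z · Σ'_y KZ(s; y → z) r(ω_y, η_y)`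
  have hAeq : ∀ z : ZdEdge d, ∑' y, Kn s s y z * suFrobDist (ω y) (η y) = A z := fun z =>
    tsum_eq_sum (s := Nb) fun y hy => by
      rw [show Kn s s y z = 0 from by_contra fun h' => hy (hKnsupp s s y z h'), zero_mul]
  have hKsum : ∀ z : ZdEdge d, Summable fun y => Kn s s y z * suFrobDist (ω y) (η y) := fun z =>
    summable_of_ne_finset_zero (s := Nb) fun y hy => by
      rw [show Kn s s y z = 0 from by_contra fun h' => hy (hKnsupp s s y z h'), zero_mul]
  have hrhs : ∀ z ∈ starWinZd c, ∑' y, KZ s y z * suFrobDist (ω y) (η y) =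
      E ^ 2 * A z + C₁ * (∑ x ∈ vertexStarZd s, ℓ s x * A x) + C₂ * u := by
    intro z hz
    have hz' : z ∈ vertexStarZd s := hz
    have hk : ∀ y, KZ s y z = E ^ 2 * Kn s s y z + C₁ * (∑ x ∈ vertexStarZd s, ℓ s x * Kn s s y x) + C₂ * L s y :=
      fun y => by rw [hKZ_apply, if_pos hz']
    simp only [hk]
    have h1 : Summable fun y => E ^ 2 * Kn s s y z * suFrobDist (ω y) (η y) :=
      ((hKsum z).mul_left (E ^ 2)).congr fun y => by ring
    have h2 : Summable fun y => C₁ * (∑ x ∈ vertexStarZd s, ℓ s x * Kn s s y x) * suFrobDist (ω y) (η y) := by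
      have : Summable fun y => ∑ x ∈ vertexStarZd s, C₁ * ℓ s x * (Kn s s y x * suFrobDist (ω y) (η y)) :=
        summable_sum fun x _ => (hKsum x).mul_left _
      refine this.congr fun y => ?_
      rw [Finset.mul_sum, Finset.sum_mul]; exact Finset.sum_congr rfl fun x _ => by ring
    have h3 : Summable fun y => C₂ * L s y * suFrobDist (ω y) (η y) := (hLsum.mul_left C₂).congr fun y => by ring
    have hsplit3 : (fun y => (E ^ 2 * Kn s s y z + C₁ * (∑ x ∈ vertexStarZd s, ℓ s x * Kn s s y x) + C₂ * L s y) *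
        suFrobDist (ω y) (η y)) = fun y => E ^ 2 * Kn s s y z * suFrobDist (ω y) (η y) +
          C₁ * (∑ x ∈ vertexStarZd s, ℓ s x * Kn s s y x) * suFrobDist (ω y) (η y) +
          C₂ * L s y * suFrobDist (ω y) (η y) := by funext y; ring
    rw [hsplit3, (h1.add h2).tsum_add h3, h1.tsum_add h2]
    have e1 : ∑' y, E ^ 2 * Kn s s y z * suFrobDist (ω y) (η y) = E ^ 2 * A z := by
      rw [← hAeq z, ← tsum_mul_left]; exact tsum_congr fun y => by ring
    have e2 : ∑' y, C₁ * (∑ x ∈ vertexStarZd s, ℓ s x * Kn s s y x) * suFrobDist (ω y) (η y) =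
        C₁ * ∑ x ∈ vertexStarZd s, ℓ s x * A x := by
      have : ∀ y, C₁ * (∑ x ∈ vertexStarZd s, ℓ s x * Kn s s y x) * suFrobDist (ω y) (η y) =
          ∑ x ∈ vertexStarZd s, C₁ * ℓ s x * (Kn s s y x * suFrobDist (ω y) (η y)) := fun y => by
        rw [Finset.mul_sum, Finset.sum_mul]; exact Finset.sum_congr rfl fun x _ => by ring
      simp_rw [this]
      rw [Summable.tsum_finsetSum (fun x _ => (hKsum x).mul_left _), Finset.mul_sum]
      refine Finset.sum_congr rfl fun x _ => ?_
      rw [tsum_mul_left, hAeq x]; ring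
    have e3 : ∑' y, C₂ * L s y * suFrobDist (ω y) (η y) = C₂ * u := by
      rw [hu, ← tsum_mul_left]; exact tsum_congr fun y => by ring
    rw [e1, e2, e3]
  -- compare with the tilt bound
  set Sℓ : ℝ := ∑ x ∈ vertexStarZd s, ℓ s x * A x with hSℓ
  have hSℓ' : ∑ x ∈ starWinZd c, ℓ s x * A x = Sℓ := hSℓ.symm
  clear_value Sℓ
  have hR : ∑ x ∈ starWinZd c, δ x * ∑' y, KZ s y x * suFrobDist (ω y) (η y) =
      ∑ x ∈ starWinZd c, (E ^ 2 * (δ x * A x) + (C₁ * Sℓ + C₂ * u) * δ x) :=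
    Finset.sum_congr rfl fun z hz => by rw [hrhs z hz]; ring
  have hsum : ∑ x ∈ starWinZd c, (E ^ 2 * (δ x * A x) + (C₁ * Sℓ + C₂ * u) * δ x) =
      E ^ 2 * (∑ z ∈ starWinZd c, δ z * A z) + (C₁ * Sℓ + C₂ * u) * ∑ z ∈ starWinZd c, δ z := by
    rw [Finset.sum_add_distrib, ← Finset.mul_sum, ← Finset.mul_sum]
  rw [hR, hsum, hSℓ', ← hE, hF, hC₁, hC₂]
  refine le_of_eq ?_
  ring
end Summit.Ventures.YMGap.RobustBall

end
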